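import Mathlib
import Summits.ValiantsHypothesis.ValiantsHypothesis.Theorems.KPlusLogSqLawTridiagonalRealStaticPotentialRow
import Summits.ValiantsHypothesis.ValiantsHypothesis.Theorems.LacunarySymmetroidMatrixDescartesDoorA26WallBubblingBubblingDefs

/-!
# The α register in EDGE NORMAL FORM: the continuant is (diagonal monomial) × (matching sum of the edge weights)

Kernel form of the paper identity used throughout the α-register memos (lift-p2 g16 `SLOPE-SUM-AND-TYPES` §3, g17
`ENS-FACES` §1): for the static symmetric tridiagonal monomial design (`pathDet a d b f k`: diagonal `a_j X^{d_j}`, links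
`b_j X^{f_j}`), at every real point `x ≠ 0` with all `a_j ≠ 0`,

  `D_k(x) = (∏_{j<k} a_j x^{d_j}) · ∑_{M matching of the path's edges 0..k−2} (−1)^{|M|} ∏_{j∈M} w_j(x)`,
  `w_j(x) = b_j² x^{2 f_j} / (a_j a_{j+1} x^{d_j + d_{j+1}})`  (`eval_pathDet_eq_matchingSum`),

proved from the three-term recurrence `pathDet_add_two` and the path-matching recurrence `matchingSum_succ_succ`
(split on the last edge).  At `x = e^t` the edge weights are `q_j e^{L_j t}` with `q_j = b_j²/(a_j a_{j+1})` and the edge SLOPES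
`L_j = 2f_j − d_j − d_{j+1}`, so the matching sum is a real EXPONENTIAL SUM over matchings with exponents the matching slope-sums
(`matchingSum_exp_eq_expSum`): the currency in which the ENS theorem (`…WallBubblingExpNewton*`: `exp_newton`,
`exp_newton_gapProduct_index`) applies to the register — positive roots of `D_k` ↔ real zeros of that sum (`eval_pathDet_exp_eq_zero_iff`).

Def-free (the matching sum is written out: sum over the powerset with the matching indicator).  HONEST FRAMING: bookkeeping
identity for the α register (item stmt-ValiantsHypothesis-19561 helper lane); nothing on `WeakLifting`/`TropicalB` in their windows,
Conjecture B, the doors, `MatrixDescartes` (18050) or `VP ≠ VNP`.  Seat: prover val-sym-lift-p2 g17, `--supports stmt-ValiantsHypothesis-19561`.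
-/

set_option linter.dupNamespace false
set_option autoImplicit false

namespace Summit.ValiantsHypothesis.ValiantsHypothesis.Theorems.KPlusLogSqLaw

namespace EdgeNormalForm

open Polynomial Finset
open Summit.ValiantsHypothesis.ValiantsHypothesis.Theorems.KPlusLogSqLaw.StaticTridiagonalRealPotential
  (pathDet pathDet_zero pathDet_one pathDet_add_two)
open Summit.ValiantsHypothesis.ValiantsHypothesis.Theorems.LacunarySymmetroidMatrixDescartes.WallBubbling.Bubbling (expSum)

/-! ## 1. The path-matching recurrence -/

/-- Inserting the new last edge `n` into `M ⊆ {0,…,n−1}`: the matching-indicator summand of `insert n M` is `−w n` times that of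
`M` when `n − 1 ∉ M`, and `0` otherwise. [folklore] -/
theorem summand_insert (w : ℕ → ℝ) (n : ℕ) (M : Finset ℕ) (hM : M ⊆ range n) :
    (if (∀ k ∈ insert n M, k + 1 ∉ insert n M) then (-1 : ℝ) ^ (insert n M).card * ∏ k ∈ insert n M, w k else 0) =
      (if n - 1 ∈ M ∧ 1 ≤ n then 0 else
        -w n * (if (∀ k ∈ M, k + 1 ∉ M) then (-1 : ℝ) ^ M.card * ∏ k ∈ M, w k else 0)) := by
  have hnM : n ∉ M := fun h => by have := mem_range.mp (hM h); omega
  have hlt : ∀ k ∈ M, k < n := fun k hk => mem_range.mp (hM hk)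
  by_cases hpred : n - 1 ∈ M ∧ 1 ≤ n
  · -- `n − 1 ∈ M`: `insert n M` is not a matching
    rw [if_pos hpred, if_neg]
    intro h
    exact h (n - 1) (mem_insert_of_mem hpred.1) (by rw [Nat.sub_add_cancel hpred.2]; exact mem_insert_self _ _)
  · rw [if_neg hpred]
    by_cases hmat : ∀ k ∈ M, k + 1 ∉ M
    · have hmat' : ∀ k ∈ insert n M, k + 1 ∉ insert n M := by
        intro k hk hk1
        rcases mem_insert.mp hk with rfl | hkM
        · rcases mem_insert.mp hk1 with h | h
          · omega
          · have := hlt _ h; omega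
        · rcases mem_insert.mp hk1 with h | h
          · apply hpred
            refine ⟨?_, by omega⟩
            have : k = n - 1 := by omega
            rw [← this]; exact hkM
          · exact hmat k hkM h
      rw [if_pos hmat', if_pos hmat, card_insert_of_notMem hnM, prod_insert hnM, pow_succ]
      ring
    · have hmat' : ¬ ∀ k ∈ insert n M, k + 1 ∉ insert n M := by
        intro h
        apply hmat
        intro k hk hk1
        exact h k (mem_insert_of_mem hk) (mem_insert_of_mem hk1)
      rw [if_neg hmat', if_neg hmat, mul_zero]

/-- **Path-matching recurrence** (split on the last edge `n+1`): with `MS r = ∑_{M ⊆ {0..r−1} matching} (−1)^{|M|} ∏_{k∈M} w_k`,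
`MS (n+2) = MS (n+1) − w_{n+1} · MS n`. [folklore] -/
theorem matchingSum_succ_succ (w : ℕ → ℝ) (n : ℕ) :
    (∑ M ∈ (range (n + 2)).powerset, (if (∀ k ∈ M, k + 1 ∉ M) then (-1 : ℝ) ^ M.card * ∏ k ∈ M, w k else 0)) =
      (∑ M ∈ (range (n + 1)).powerset, (if (∀ k ∈ M, k + 1 ∉ M) then (-1 : ℝ) ^ M.card * ∏ k ∈ M, w k else 0)) -
        w (n + 1) * (∑ M ∈ (range n).powerset, (if (∀ k ∈ M, k + 1 ∉ M) then (-1 : ℝ) ^ M.card * ∏ k ∈ M, w k else 0)) := by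
  rw [range_add_one, sum_powerset_insert (by simp)]
  congr 1
  -- the matchings through the last edge `n+1`
  have step1 : ∑ M ∈ (range (n + 1)).powerset,
      (if (∀ k ∈ insert (n + 1) M, k + 1 ∉ insert (n + 1) M) then
        (-1 : ℝ) ^ (insert (n + 1) M).card * ∏ k ∈ insert (n + 1) M, w k else 0) =
      ∑ M ∈ (range (n + 1)).powerset, (if n ∈ M then 0 else
        -w (n + 1) * (if (∀ k ∈ M, k + 1 ∉ M) then (-1 : ℝ) ^ M.card * ∏ k ∈ M, w k else 0)) := by
    refine sum_congr rfl fun M hM => ?_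
    rw [summand_insert w (n + 1) M (mem_powerset.mp hM)]
    simp only [Nat.add_sub_cancel, Nat.le_add_left, and_true]
  rw [step1, range_add_one, sum_powerset_insert (by simp)]
  have hvan : ∑ M ∈ (range n).powerset, (if n ∈ insert n M then (0 : ℝ) else
      -w (n + 1) * (if (∀ k ∈ insert n M, k + 1 ∉ insert n M) then
        (-1 : ℝ) ^ (insert n M).card * ∏ k ∈ insert n M, w k else 0)) = 0 :=
    sum_eq_zero fun M _ => by rw [if_pos (mem_insert_self _ _)]
  rw [hvan, add_zero, ← neg_mul, mul_sum]
  refine sum_congr rfl fun M hM => ?_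
  have hnM : n ∉ M := fun h => by have := mem_range.mp (mem_powerset.mp hM h); omega
  rw [if_neg hnM, neg_mul]

/-! ## 2. The continuant in edge normal form -/

variable (a : ℕ → ℝ) (d : ℕ → ℕ) (b : ℕ → ℝ) (f : ℕ → ℕ)

/-- **EDGE NORMAL FORM of the continuant.**  For `x ≠ 0` and all diagonal coefficients `a_j ≠ 0`:
`D_k(x) = (∏_{j<k} a_j x^{d_j}) · ∑_{M ⊆ {0..k−2} matching} (−1)^{|M|} ∏_{j∈M} w_j(x)` with the EDGE WEIGHTS
`w_j(x) = b_j² x^{2f_j} / (a_j a_{j+1} x^{d_j + d_{j+1}})`. [folklore: continuants ↔ path matchings; this file] -/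
theorem eval_pathDet_eq_matchingSum (x : ℝ) (hx : x ≠ 0) (ha : ∀ j, a j ≠ 0) :
    ∀ k, (pathDet a d b f k).eval x =
      (∏ j ∈ range k, a j * x ^ d j) *
        ∑ M ∈ (range (k - 1)).powerset, (if (∀ j ∈ M, j + 1 ∉ M) then
          (-1 : ℝ) ^ M.card * ∏ j ∈ M, (b j ^ 2 * x ^ (2 * f j) / (a j * a (j + 1) * x ^ (d j + d (j + 1)))) else 0) := by
  intro k
  induction k using Nat.strong_induction_on with
  | _ k ih =>
    rcases k with _ | _ | n
    · simp [pathDet_zero]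
    · simp [pathDet_one]
    · rw [pathDet_add_two]
      simp only [eval_sub, eval_mul, eval_pow, eval_C, eval_X]
      rw [ih (n + 1) (by omega), ih n (by omega)]
      rw [show n + 2 - 1 = n + 1 from rfl, show n + 1 - 1 = n from rfl]
      rcases n with _ | n
      · -- k = 2: `D₂ = a₁ x^{d₁} · a₀ x^{d₀} − b₀² x^{2f₀}`; matchings of one edge: `∅`, `{0}`
        simp only [Nat.zero_add, Nat.reduceAdd, Nat.zero_sub, range_zero, powerset_empty, sum_singleton, notMem_empty,
          IsEmpty.forall_iff, implies_true, if_true, card_empty, pow_zero, prod_empty, mul_one, range_one]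
        rw [show ({0} : Finset ℕ).powerset = {∅, {0}} from by decide, sum_pair (by decide)]
        simp only [notMem_empty, IsEmpty.forall_iff, implies_true, if_true, card_empty, pow_zero, prod_empty,
          mem_singleton, forall_eq, card_singleton, pow_one, prod_singleton, Nat.zero_add]
        rw [if_pos (by norm_num), prod_range_succ, prod_range_succ, prod_range_zero]
        have h0 : a 0 ≠ 0 := ha 0
        have h1 : a 1 ≠ 0 := ha 1
        field_simp
        ring
      · rw [show n + 1 - 1 = n from rfl, matchingSum_succ_succ, prod_range_succ _ (n + 2), prod_range_succ _ (n + 1)]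
        have h0 : a (n + 1) ≠ 0 := ha (n + 1)
        have h1 : a (n + 2) ≠ 0 := ha (n + 2)
        have hxp : ∀ e : ℕ, x ^ e ≠ 0 := fun e => pow_ne_zero e hx
        field_simp
        ring

/-- **Zeros.**  For `x > 0` (indeed `x ≠ 0`) and `a_j ≠ 0` the positive roots of `D_k` are exactly the zeros of the matching sum. [this file] -/
theorem eval_pathDet_eq_zero_iff (x : ℝ) (hx : x ≠ 0) (ha : ∀ j, a j ≠ 0) (k : ℕ) :
    (pathDet a d b f k).eval x = 0 ↔
      (∑ M ∈ (range (k - 1)).powerset, (if (∀ j ∈ M, j + 1 ∉ M) then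
          (-1 : ℝ) ^ M.card * ∏ j ∈ M, (b j ^ 2 * x ^ (2 * f j) / (a j * a (j + 1) * x ^ (d j + d (j + 1)))) else 0)) = 0 := by
  rw [eval_pathDet_eq_matchingSum a d b f x hx ha k, mul_eq_zero]
  have hP : (∏ j ∈ range k, a j * x ^ d j) ≠ 0 := prod_ne_zero_iff.mpr fun j _ => mul_ne_zero (ha j) (pow_ne_zero _ hx)
  exact ⟨fun h => h.resolve_left hP, fun h => Or.inr h⟩

/-! ## 3. At `x = e^t`: an exponential sum over matchings with exponents the matching slope-sums -/

/-- The edge weight at `x = e^t` is `q_j · e^{L_j t}` with `q_j = b_j²/(a_j a_{j+1})` and slope `L_j = 2 f_j − d_j − d_{j+1}`. [this file] -/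
theorem edgeWeight_exp (t : ℝ) (j : ℕ) :
    b j ^ 2 * Real.exp t ^ (2 * f j) / (a j * a (j + 1) * Real.exp t ^ (d j + d (j + 1))) =
      b j ^ 2 / (a j * a (j + 1)) * Real.exp (((2 * (f j : ℝ) - d j - d (j + 1))) * t) := by
  rw [← Real.exp_nat_mul, ← Real.exp_nat_mul, show ((2 * (f j : ℝ) - d j - d (j + 1))) * t =
      ((2 * f j : ℕ) : ℝ) * t - ((d j + d (j + 1) : ℕ) : ℝ) * t by push_cast; ring, Real.exp_sub]
  have h1 : Real.exp (((d j + d (j + 1) : ℕ) : ℝ) * t) ≠ 0 := (Real.exp_pos _).ne'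
  field_simp

/-- **The matching sum at `x = e^t` is a real exponential sum** over the matchings (index type: the subsets of the edge set,
non-matchings carrying coefficient `0`), with coefficient `(−1)^{|M|} q^M` and exponent the matching SLOPE-SUM `σ_M = ∑_{j∈M} L_j`.
This is the currency of `exp_newton` / `exp_newton_gapProduct_index` (`…WallBubblingExpNewton*`). [this file] -/
theorem matchingSum_exp_eq_expSum (t : ℝ) (r : ℕ) :
    (∑ M ∈ (range r).powerset, (if (∀ j ∈ M, j + 1 ∉ M) then
        (-1 : ℝ) ^ M.card * ∏ j ∈ M, (b j ^ 2 * Real.exp t ^ (2 * f j) / (a j * a (j + 1) * Real.exp t ^ (d j + d (j + 1)))) else 0)) =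
      expSum (ι := ↥((range r).powerset))
        (fun M => if (∀ j ∈ (M : Finset ℕ), j + 1 ∉ (M : Finset ℕ)) then
          (-1 : ℝ) ^ (M : Finset ℕ).card * ∏ j ∈ (M : Finset ℕ), b j ^ 2 / (a j * a (j + 1)) else 0)
        (fun M => ∑ j ∈ (M : Finset ℕ), (2 * (f j : ℝ) - d j - d (j + 1))) t := by
  unfold expSum
  rw [← sum_coe_sort]
  refine sum_congr rfl fun M _ => ?_
  dsimp only
  by_cases hmat : ∀ j ∈ (M : Finset ℕ), j + 1 ∉ (M : Finset ℕ)
  · rw [if_pos hmat, if_pos hmat, mul_assoc]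
    congr 1
    rw [sum_mul, Real.exp_sum, ← prod_mul_distrib]
    exact prod_congr rfl fun j _ => edgeWeight_exp a d b f t j
  · rw [if_neg hmat, if_neg hmat, zero_mul]

/-- **Positive roots of the continuant = real zeros of the matching exponential sum.**  For `a_j ≠ 0`:
`D_k(e^t) = 0 ↔` the exponential sum of `matchingSum_exp_eq_expSum` (with `r = k − 1`) vanishes at `t`. [this file] -/
theorem eval_pathDet_exp_eq_zero_iff (ha : ∀ j, a j ≠ 0) (k : ℕ) (t : ℝ) :
    (pathDet a d b f k).eval (Real.exp t) = 0 ↔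
      expSum (ι := ↥((range (k - 1)).powerset))
        (fun M => if (∀ j ∈ (M : Finset ℕ), j + 1 ∉ (M : Finset ℕ)) then
          (-1 : ℝ) ^ (M : Finset ℕ).card * ∏ j ∈ (M : Finset ℕ), b j ^ 2 / (a j * a (j + 1)) else 0)
        (fun M => ∑ j ∈ (M : Finset ℕ), (2 * (f j : ℝ) - d j - d (j + 1))) t = 0 := by
  rw [eval_pathDet_eq_zero_iff a d b f (Real.exp t) (Real.exp_pos t).ne' ha k, matchingSum_exp_eq_expSum]

end EdgeNormalForm

end Summit.ValiantsHypothesis.ValiantsHypothesis.Theorems.KPlusLogSqLaw
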